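import Mathlib
import Summits.Ventures.DiscreteObjects.Mahler.SmythTrinomialIrreducible
import Summits.Ventures.DiscreteObjects.Mahler.SmythIsolationHardy

/-!
# Selmer's theorem: `xⁿ - x - 1` is irreducible, via Smyth's inequality (venture `DiscreteObjects`, target L)

Cell `pub-namedobj`, seat `pub-namedobj-mahler` (gen 9). Framing: lottery ticket; floor = certified
bounds/negative ranges.

[McKee–Smyth, *Around the Unit Circle*, Exercise 12.4] (Selmer 1956): for every `n ≥ 2` the trinomial
`zⁿ - z - 1` is irreducible over `ℤ`.  The book's route, formalised: `zⁿ - z - 1` has no root pair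
`β, β⁻¹` (so no nonconstant reciprocal or antireciprocal factor), hence every nonconstant factor has
Mahler measure `≥ θ₀` by Smyth's theorem; two such factors would force `M(zⁿ - z - 1) ≥ θ₀² = 1.7548…`,
whereas Landau's inequality (Mathlib `mahlerMeasure_le_sqrt_sum_sq_norm_coeff`; the book uses
Gonçalves') gives `M(zⁿ - z - 1) ≤ √3 = 1.7320…`.

* `natDegree_eq_zero_of_reciprocal_dvd'`, `irreducible_of_mahlerMeasure_lt_smythTheta_sq` — the
  general principle: `T(0) = ±1`, `M(T) < θ₀²`, no root pair `β, β⁻¹` ⟹ `T` irreducible;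
* `X_pow_sub_X_sub_one_no_inverse_pair` — `βⁿ = β + 1` and `β⁻ⁿ = β⁻¹ + 1` are incompatible;
* `intMahlerMeasure_X_pow_sub_X_sub_one_le` — `M(zⁿ - z - 1) ≤ √3`;
* `irreducible_X_pow_sub_X_sub_one` — **Selmer's theorem**.
-/

namespace Summit.Ventures.DiscreteObjects.Mahler

open Polynomial Finset

/-! ### The general principle -/

/-- A (anti)reciprocal factor of an integer polynomial with constant term `±1` and no complex root pair
`β, β⁻¹` is constant. -/
theorem natDegree_eq_zero_of_reciprocal_dvd' {A T : ℤ[X]} (hT0 : T.coeff 0 = 1 ∨ T.coeff 0 = -1)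
    (hT : ∀ β : ℂ, β ≠ 0 → (T.map (Int.castRingHom ℂ)).eval β = 0 →
      (T.map (Int.castRingHom ℂ)).eval β⁻¹ = 0 → False)
    (hdvd : A ∣ T) (hrec : A.reverse = A ∨ A.reverse = -A) : A.natDegree = 0 := by
  rcases hT0 with h | h
  · exact natDegree_eq_zero_of_reciprocal_dvd h hT hdvd hrec
  · -- apply the `T(0) = 1` version to `-T`
    refine natDegree_eq_zero_of_reciprocal_dvd (T := -T) (by rw [coeff_neg, h, neg_neg]) ?_
      ((dvd_neg).mpr hdvd) hrec
    intro β hβ h1 h2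
    rw [Polynomial.map_neg, eval_neg, neg_eq_zero] at h1 h2
    exact hT β hβ h1 h2

/-- **Irreducibility below `θ₀²`.**  An integer polynomial `T` with `T(0) = ±1`, `deg T ≥ 1`,
`M(T) < θ₀²` and no complex root pair `β, β⁻¹` is irreducible over `ℤ`: its nonconstant factors are
nonreciprocal with nonzero constant term, hence of measure `≥ θ₀` each (Smyth). -/
theorem irreducible_of_mahlerMeasure_lt_smythTheta_sq {T : ℤ[X]} (hT0 : T.coeff 0 = 1 ∨ T.coeff 0 = -1)
    (hTdeg : 0 < T.natDegree) (hMT : intMahlerMeasure T < smythTheta * smythTheta)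
    (hT : ∀ β : ℂ, β ≠ 0 → (T.map (Int.castRingHom ℂ)).eval β = 0 →
      (T.map (Int.castRingHom ℂ)).eval β⁻¹ = 0 → False) : Irreducible T := by
  refine irreducible_iff.mpr ⟨fun hu => ?_, fun A B hAB => ?_⟩
  · have := natDegree_eq_zero_of_isUnit hu
    omega
  have hc : A.coeff 0 * B.coeff 0 = 1 ∨ A.coeff 0 * B.coeff 0 = -1 := by rw [← mul_coeff_zero, ← hAB]; exact hT0
  have hA0 : A.coeff 0 = 1 ∨ A.coeff 0 = -1 := by
    rcases hc with h | h
    · exact Int.eq_one_or_neg_one_of_mul_eq_one h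
    · exact Int.eq_one_or_neg_one_of_mul_eq_neg_one h
  have hB0 : B.coeff 0 = 1 ∨ B.coeff 0 = -1 := by
    rcases hc with h | h
    · exact Int.eq_one_or_neg_one_of_mul_eq_one (by rw [mul_comm]; exact h)
    · exact Int.eq_one_or_neg_one_of_mul_eq_neg_one (by rw [mul_comm]; exact h)
  have unit_of_const : ∀ {D : ℤ[X]}, (D.coeff 0 = 1 ∨ D.coeff 0 = -1) → D.natDegree = 0 → IsUnit D := by
    intro D hD0 hD
    rw [eq_C_of_natDegree_eq_zero hD, isUnit_C]
    rcases hD0 with h | h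
    · rw [h]; exact isUnit_one
    · rw [h]; exact isUnit_one.neg
  by_cases hA : A.natDegree = 0
  · exact Or.inl (unit_of_const hA0 hA)
  by_cases hB : B.natDegree = 0
  · exact Or.inr (unit_of_const hB0 hB)
  exfalso
  have hAdvd : A ∣ T := ⟨B, hAB⟩
  have hBdvd : B ∣ T := ⟨A, by rw [hAB, mul_comm]⟩
  have hA1 : A.reverse ≠ A := fun h => hA (natDegree_eq_zero_of_reciprocal_dvd' hT0 hT hAdvd (Or.inl h))
  have hA2 : A.reverse ≠ -A := fun h => hA (natDegree_eq_zero_of_reciprocal_dvd' hT0 hT hAdvd (Or.inr h))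
  have hB1 : B.reverse ≠ B := fun h => hB (natDegree_eq_zero_of_reciprocal_dvd' hT0 hT hBdvd (Or.inl h))
  have hB2 : B.reverse ≠ -B := fun h => hB (natDegree_eq_zero_of_reciprocal_dvd' hT0 hT hBdvd (Or.inr h))
  have hA0' : A.coeff 0 ≠ 0 := by rcases hA0 with h | h <;> rw [h] <;> norm_num
  have hB0' : B.coeff 0 ≠ 0 := by rcases hB0 with h | h <;> rw [h] <;> norm_num
  have hMA := intMahlerMeasure_ge_smythTheta_of_nonreciprocal hA0' hA1 hA2
  have hMB := intMahlerMeasure_ge_smythTheta_of_nonreciprocal hB0' hB1 hB2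
  have hθ := smythTheta_pos
  have : smythTheta * smythTheta ≤ intMahlerMeasure T := by
    rw [hAB, intMahlerMeasure_mul]
    exact mul_le_mul hMA hMB hθ.le (le_trans hθ.le hMA)
  linarith

/-! ### `zⁿ - z - 1` -/

/-- `βⁿ = β + 1` and `β⁻ⁿ = β⁻¹ + 1` cannot both hold (`n ≥ 2`, `β ≠ 0`). -/
theorem X_pow_sub_X_sub_one_no_inverse_pair {m : ℕ} {β : ℂ} (hβ : β ≠ 0)
    (h1 : β ^ (m + 2) - β - 1 = 0) (h2 : β⁻¹ ^ (m + 2) - β⁻¹ - 1 = 0) : False := by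
  have key : 1 - β ^ (m + 1) - β ^ (m + 2) = 0 := by
    have e1 : β⁻¹ ^ (m + 2) * β ^ (m + 2) = 1 := by rw [← mul_pow, inv_mul_cancel₀ hβ, one_pow]
    have e2 : β⁻¹ * β ^ (m + 2) = β ^ (m + 1) := by
      rw [pow_succ, mul_comm, mul_assoc, mul_inv_cancel₀ hβ, mul_one]
    have e : (β⁻¹ ^ (m + 2) - β⁻¹ - 1) * β ^ (m + 2) =
        β⁻¹ ^ (m + 2) * β ^ (m + 2) - β⁻¹ * β ^ (m + 2) - β ^ (m + 2) := by ring
    rw [h2, zero_mul, e1, e2] at e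
    linear_combination -e
  have hA : β ^ m * β = -1 * β := by linear_combination -key - h1
  have hBm : β ^ m = -1 := mul_right_cancel₀ hβ hA
  have hC : β ^ 2 + β + 1 = 0 := by linear_combination -h1 + β ^ 2 * hBm
  have hD : β ^ 3 = 1 := by linear_combination (β - 1) * hC
  -- `β^m = β^(m % 3)` since `β³ = 1`
  have hmod : β ^ m = β ^ (m % 3) := by
    conv_lhs => rw [← Nat.div_add_mod m 3, pow_add, pow_mul, hD, one_pow, one_mul]
  rw [hmod] at hBm
  have hr : m % 3 < 3 := Nat.mod_lt _ (by norm_num)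
  interval_cases (m % 3)
  · norm_num at hBm
  · rw [pow_one] at hBm
    rw [hBm] at hC; norm_num at hC
  · rw [hBm] at hC
    have : β = 0 := by linear_combination hC
    exact hβ this

/-- **`M(zⁿ - z - 1) ≤ √3`** (`n ≥ 2`), by Landau's inequality. -/
theorem intMahlerMeasure_X_pow_sub_X_sub_one_le {n : ℕ} (hn : 2 ≤ n) :
    intMahlerMeasure (X ^ n - X - 1 : ℤ[X]) ≤ Real.sqrt 3 := by
  unfold intMahlerMeasure
  set p : ℂ[X] := C (1 : ℂ) * X ^ n + C (-1 : ℂ) * X ^ 1 + C (-1 : ℂ) * X ^ 0 with hp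
  have hmap : ((X ^ n - X - 1 : ℤ[X]).map (Int.castRingHom ℂ)) = p := by
    rw [hp]
    simp only [Polynomial.map_sub, Polynomial.map_pow, Polynomial.map_X, Polynomial.map_one, map_one, map_neg,
      pow_one, pow_zero, one_mul, neg_mul, mul_one]
    ring
  rw [hmap]
  refine le_trans (mahlerMeasure_le_sqrt_sum_sq_norm_coeff p) (Real.sqrt_le_sqrt ?_)
  have hsum := sum_norm_sq_coeff_trinomial (1 : ℂ) (-1) (-1) (m₀ := n) (m₁ := 1) (m₂ := 0)
    (by omega) (by omega) (by omega)
  rw [← hp] at hsum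
  have h3 : ‖(1 : ℂ)‖ ^ 2 + ‖(-1 : ℂ)‖ ^ 2 + ‖(-1 : ℂ)‖ ^ 2 = 3 := by norm_num
  rw [h3] at hsum
  have hle : ∑ i ∈ p.support, ‖p.coeff i‖ ^ 2 ≤ ∑ i ∈ range (p.natDegree + 1), ‖p.coeff i‖ ^ 2 :=
    sum_le_sum_of_subset_of_nonneg supp_subset_range_natDegree_succ (fun i _ _ => sq_nonneg ‖p.coeff i‖)
  linarith

/-- **Selmer's theorem** (Selmer 1956; [McKee–Smyth, Exercise 12.4]): `zⁿ - z - 1` is irreducible over `ℤ`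
for every `n ≥ 2`. -/
theorem irreducible_X_pow_sub_X_sub_one {n : ℕ} (hn : 2 ≤ n) : Irreducible (X ^ n - X - 1 : ℤ[X]) := by
  obtain ⟨m, rfl⟩ : ∃ m, n = m + 2 := ⟨n - 2, by omega⟩
  have hθ := smythTheta_gt
  refine irreducible_of_mahlerMeasure_lt_smythTheta_sq (Or.inr ?_) ?_ ?_ ?_
  · simp [coeff_sub, coeff_X_pow, coeff_X_zero, coeff_one_zero]
  · refine lt_of_lt_of_le (by omega : 0 < m + 2) (le_natDegree_of_ne_zero ?_)
    rw [coeff_sub, coeff_sub, coeff_X_pow, if_pos rfl, coeff_X, if_neg (by omega), coeff_one,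
      if_neg (by omega)]
    norm_num
  · refine lt_of_le_of_lt (intMahlerMeasure_X_pow_sub_X_sub_one_le hn) ?_
    have h3 : Real.sqrt 3 < 1754 / 1000 := by
      rw [Real.sqrt_lt' (by norm_num)]; norm_num
    nlinarith
  · intro β hβ h1 h2
    simp only [Polynomial.map_sub, Polynomial.map_pow, Polynomial.map_X, Polynomial.map_one, eval_sub,
      eval_pow, eval_X, eval_one] at h1 h2
    exact X_pow_sub_X_sub_one_no_inverse_pair hβ h1 h2

end Summit.Ventures.DiscreteObjects.Mahler
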